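import Literature.NumberTheory.Rogawski1990.ArchHcJumpWordLetters                 -- ★ FILE 2a (F0P3a-p08 (g23)): letters in coordinates, charts as CLMs, counts, cofactor Wick in words; brings ★ `ArchHCSpaceG`, ★ local normal form
import Literature.NumberTheory.Automorphic.Shelstad1979.OneSidedJumpLeibniz        -- ★ (F0P3a-p09): `hasOneSidedJump_iteratedFDeriv_mul_ray_of_jumps`; brings ★ `iteratedFDeriv_mul_apply_eq_sum_powerset`
import HarnessLib

/-!
# (I₃) ADAPTED WORDS: the jump of every adapted-word jet of the twisted family from a TWO-CHART DESCENT FAMILY — `jump = (K₁∕K₂)·κ · I^{#normal} · (Cayley-word jet)`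
# (Harish-Chandra; Varadarajan 1977 I §1.12; Shelstad 1979 Lemma 4.3, Prop. 4.5; Bouaziz 1994 §3.2 (I₃))

Topic `NumberTheory/Rogawski1990`; namespace `Literature.NumberTheory.Rogawski1990`.  THEOREMS ONLY (no `def`, no instance, no notation, no axiom, no named fact, no `sorry`);
GROUP-FREE.  Cell `pub/hodgecm-mathlib`, crux H413 (`stmt-HodgeConjecture-24833`), F0∕P3c line LH3 (closer stub `stub_N9`, leaf `F0_P3c_StubN9Direct`, letter L1 clause (I₃)
`ArchHcJump`), SPEC-I3 brick **(B-trans)** (RULING #14, F0P3a-p08 (g23)), FILE 2b = THE ASSEMBLY IN GIVEN-FORM.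

THE STATEMENT (`hasOneSidedJump_iteratedFDeriv_adaptedWord_of_twoChart`).  At a wall point `p` (`p w i = p w j`) of the noncompact wall `(w,i,j)`, GIVEN
* two READERS `Φ₁` (on `Q ×ˢ T₁`, `T₁ ∋` the punctured normal interval) and `Φ₂` (on `Q ×ˢ univ`) of an admissible class `Adm` closed under transversal derivatives `D v`, each `C^∞` (H1)
  and differentiating its family under itself (H2) — (B-par) ★ p851003∕`ArchRankOneOrbitalFamilyParam` for the (ELL-∞) functional `F` and the split functional `Λ`;
* ONE admissible family `g` and the two DESCENT IDENTITIES: on the compact chart near `p`, off the wall,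
  `F₁ c = K₁·(ce (ν c)·Pf (π c) − Ef (π c)) · Φ₁ (g (π c)) (ν c)` ((B-desc) box edition ★ p851016 dressed by ★ (c-wall)∕(R4): `'F_{S′} = K·R·F`), and on the split chart near the
  Cayley point, THROUGH the real wall, `F₂ c″ = K₂·(ch (x c″)·Pf (B c″) − Ef (B c″)) · Φ₂ (g (B c″)) (x c″)` ((B-desc-hyp), F0P3a-p05);
* the 1-D WICK input `iteratedDeriv a ce 0 = I^a · iteratedDeriv a ch 0` (★ LH1-p03 (R4) `iteratedDeriv_ofReal_two_cos_sub_zero_eq_I_pow_mul` at `δ = π∕2`);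
* the RANK-ONE ALL-ORDERS JUNCTION for every admissible member at the base parameter: `HasOneSidedJump (iteratedDeriv a (Φ₁ (g′ p))) (κ · I^a · iteratedDeriv a (Φ₂ (g′ p)) 0)`
  ((B-r1) = (A0-CASIMIR-∞) FILE 4, F0P3a-p09);
THEN for EVERY word `m : Fin n → W × Fin 3` of adapted letters:
`HasOneSidedJump (ν ↦ Dⁿ F₁ (p + ν • hcNrm w i j) (hcAdaptedVec ∘ m)) ((K₁∕K₂)·κ · hcCayScalar w i m · Dⁿ F₂ (hcCayPt w i j p) (hcCayVec ∘ m))` — the `ArchHcJump` clause at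
`(S′, w, i, j, p)` for `F₁ = archERhoG S′ · orbFamGExt S′`, `F₂ = archERhoG (insert w S′) · orbFamGExt (insert w S′)`, `jc′ S′ w i j := (K₁∕K₂)·κ` — ONE constant for all `n, m, p, a′`
as long as `K₁, K₂, κ` are wall data ((Q) of SPEC-I3).
PROOF.  Both charts are read through the continuous linear maps `A₁ c = (π c, ν c)`, `A₂ c″ = (B c″, x c″)` (★ FILE 2a): the adapted word and the Cayley word become THE SAME word `ŵ`
of `(0,1)`∕`(v,0)` letters on `(W → Fin 3 → ℝ) × ℝ`, the base points become `(p, ν)` and `(p, 0)`.  On the product: ★ Leibniz-for-jumps along the ray `(p,0) + ν•(0,1)` with the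
smooth cofactor `M₁` and the reader `H₁`, whose sub-word jets are put in NORMAL FORM by ★ `iteratedFDeriv_readers_eq_iteratedDeriv_foldr_local` (readers `{Φ₁, Φ₂}` at once ⇒ ONE
differentiated family `g′_s` per sub-word), so (B-r1) supplies every sub-word jump; the split side is ★ pointwise Leibniz + the same normal form at `(p, 0)`; the cofactor jets
match by ★ `cofactor_wick_words`; the powers of `I` collect into `hcCayScalar` (★ `I_pow_mul_I_pow_eq_hcCayScalar`).
HONEST LABEL: count-neutral; HC_CM is proved only modulo the 7 printed citations (2 remaining: hLiu418 = stmt-HodgeConjecture-24832, h413 = stmt-HodgeConjecture-24833) until rung 0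
closes.  This file pays (I₃) for the GENUINE family only once its four GIVEN inputs are ★ and instantiated ((B-asm)).

## References
* [Varadarajan1977] V. S. Varadarajan, *Harmonic Analysis on Real Reductive Groups*, LNM 576 (1977), Part I §1.12 (jump relations of `'F_f`, descent to `M`).
* [Shelstad1979] D. Shelstad, *Characters and inner forms of a quasi-split group over ℝ*, Compositio Math. 39 (1979), Lemma 4.3 p. 25, Prop. 4.5 p. 26.
* [Bouaziz1994IntegralesOrbitales] A. Bouaziz, *Intégrales orbitales sur les groupes de Lie réductifs*, Ann. Sci. ÉNS 27 (1994), §3.2 (I₃) p. 580.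
-/

set_option autoImplicit false

open Set Filter Function Finset Complex
open scoped Topology ContDiff
open Literature.NumberTheory.Automorphic.Shelstad1979.StableOrbitalIntegrals Literature.Analysis.Calculus

namespace Literature.NumberTheory.Rogawski1990

/-- One-sided jumps are stable under eventual equality on the punctured neighbourhood (private copy of ★ `hasOneSidedJump_congr_eventuallyEq`, light imports).
[cite: Shelstad1979, §4 p. 25] -/
private theorem hasOneSidedJump_congr_ev {f g : ℝ → ℂ} {J : ℂ} (h : HasOneSidedJump f J) (hfg : ∀ᶠ ν in 𝓝[≠] (0 : ℝ), f ν = g ν) :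
    HasOneSidedJump g J := by
  obtain ⟨Lp, Lm, hp, hm, hJ⟩ := h
  exact ⟨Lp, Lm, hp.congr' (hfg.filter_mono (nhdsGT_le_nhdsNE 0)), hm.congr' (hfg.filter_mono (nhdsLT_le_nhdsNE 0)), hJ⟩

variable {W : Type*} [Fintype W] [DecidableEq W]

/-- **(I₃) FOR ADAPTED WORDS FROM A TWO-CHART DESCENT FAMILY** (SPEC-I3 (B-trans), GIVEN-form; see the module docstring for the reading of each hypothesis).
For every word `m` of adapted letters the jet `ν ↦ Dⁿ F₁ (p + ν • hcNrm w i j) (hcAdaptedVec ∘ m)` has both one-sided limits at `ν = 0` and jumps by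
`(K₁ ∕ K₂)·κ · hcCayScalar w i m · Dⁿ F₂ (hcCayPt w i j p) (hcCayVec ∘ m)`. [cite: Varadarajan1977, I §1.12] [cite: Shelstad1979, Lemma 4.3 (p. 25), Prop. 4.5 (p. 26)]
[cite: Bouaziz1994IntegralesOrbitales, §3.2 (I₃) p. 580] -/
theorem hasOneSidedJump_iteratedFDeriv_adaptedWord_of_twoChart (w : W) {i j : Fin 3} (hij : i ≠ j)
    {Y V : Type*} (Φ₁ Φ₂ : (Y → V) → ℝ → ℂ) {T₁ : Set ℝ} (hT₁ : IsOpen T₁) (hray : ∀ᶠ t : ℝ in 𝓝[≠] 0, t ∈ T₁)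
    (Adm : ((W → Fin 3 → ℝ) → Y → V) → Prop) (D : (W → Fin 3 → ℝ) → ((W → Fin 3 → ℝ) → Y → V) → ((W → Fin 3 → ℝ) → Y → V))
    (hcl : ∀ g, Adm g → ∀ v, Adm (D v g)) {Q : Set (W → Fin 3 → ℝ)} (hQ : IsOpen Q)
    (h1₁ : ∀ g, Adm g → ContDiffOn ℝ ∞ (fun z : (W → Fin 3 → ℝ) × ℝ => Φ₁ (g z.1) z.2) (Q ×ˢ T₁))
    (h2₁ : ∀ g, Adm g → ∀ (v : W → Fin 3 → ℝ) (z : (W → Fin 3 → ℝ) × ℝ), z ∈ Q ×ˢ T₁ →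
      fderiv ℝ (fun z : (W → Fin 3 → ℝ) × ℝ => Φ₁ (g z.1) z.2) z (v, 0) = Φ₁ (D v g z.1) z.2)
    (h1₂ : ∀ g, Adm g → ContDiffOn ℝ ∞ (fun z : (W → Fin 3 → ℝ) × ℝ => Φ₂ (g z.1) z.2) (Q ×ˢ (univ : Set ℝ)))
    (h2₂ : ∀ g, Adm g → ∀ (v : W → Fin 3 → ℝ) (z : (W → Fin 3 → ℝ) × ℝ), z ∈ Q ×ˢ (univ : Set ℝ) →
      fderiv ℝ (fun z : (W → Fin 3 → ℝ) × ℝ => Φ₂ (g z.1) z.2) z (v, 0) = Φ₂ (D v g z.1) z.2)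
    (g : (W → Fin 3 → ℝ) → Y → V) (hg : Adm g)
    (Pf Ef : (W → Fin 3 → ℝ) → ℂ) (hPf : ContDiffOn ℝ ∞ Pf Q) (hEf : ContDiffOn ℝ ∞ Ef Q)
    (ce ch : ℝ → ℂ) (hce : ContDiff ℝ ∞ ce) (hch : ContDiff ℝ ∞ ch) (hwick : ∀ a : ℕ, iteratedDeriv a ce 0 = I ^ a * iteratedDeriv a ch 0)
    (K₁ K₂ κ : ℂ) (hK₂ : K₂ ≠ 0)
    {p : W → Fin 3 → ℝ} (hp : p w i = p w j) (hpQ : p ∈ Q)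
    (F₁ F₂ : (W → Fin 3 → ℝ) → ℂ) {U₁ U₂ : Set (W → Fin 3 → ℝ)} (hU₁ : IsOpen U₁) (hpU₁ : p ∈ U₁) (hU₂ : IsOpen U₂) (hpU₂ : hcCayPt w i j p ∈ U₂)
    (hdesc₁ : ∀ c ∈ U₁, (c w i - c w j) / 2 ∈ T₁ →
      F₁ c = K₁ * (ce ((c w i - c w j) / 2) * Pf (c - ((c w i - c w j) / 2) • hcNrm w i j) - Ef (c - ((c w i - c w j) / 2) • hcNrm w i j)) *
        Φ₁ (g (c - ((c w i - c w j) / 2) • hcNrm w i j)) ((c w i - c w j) / 2))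
    (hdesc₂ : ∀ c ∈ U₂,
      F₂ c = K₂ * (ch (c w 0) * Pf (Function.update c w (fun s => if s = hcThird i j then c w 1 else c w 2)) -
          Ef (Function.update c w (fun s => if s = hcThird i j then c w 1 else c w 2))) *
        Φ₂ (g (Function.update c w (fun s => if s = hcThird i j then c w 1 else c w 2))) (c w 0))
    (hjump : ∀ g', Adm g' → ∀ a : ℕ, HasOneSidedJump (fun t : ℝ => iteratedDeriv a (Φ₁ (g' p)) t) (κ * I ^ a * iteratedDeriv a (Φ₂ (g' p)) 0))
    (n : ℕ) (m : Fin n → W × Fin 3) :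
    HasOneSidedJump (fun ν : ℝ => iteratedFDeriv ℝ n F₁ (p + ν • hcNrm w i j) (fun r => hcAdaptedVec w i j (m r)))
      (K₁ / K₂ * κ * hcCayScalar w i m * iteratedFDeriv ℝ n F₂ (hcCayPt w i j p) (fun r => hcCayVec w i j (m r))) := by
  classical
  -- the two charts as continuous linear maps and the COMMON word
  obtain ⟨A₁, hA₁⟩ := exists_clm_wallChart w i j
  obtain ⟨A₂, hA₂⟩ := exists_clm_cayleyChart w i j
  let wd : Fin n → (W → Fin 3 → ℝ) × ℝ := fun r => if m r = (w, i) then ((0 : (W → Fin 3 → ℝ)), (1 : ℝ)) else (hcAdaptedVec w i j (m r), 0)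
  let σ : Fin n → Bool := fun r => decide (m r = (w, i))
  have hwA₁ : (fun r => A₁ (hcAdaptedVec w i j (m r))) = wd := funext fun r => wallChart_hcAdaptedVec hij hA₁ (m r)
  have hwA₂ : (fun r => A₂ (hcCayVec w i j (m r))) = wd := funext fun r => cayleyChart_hcCayVec hij hA₂ (m r)
  have hwn : ∀ {k : ℕ} (e : Fin k → Fin n) (r : Fin k), (σ ∘ e) r = true → (wd ∘ e) r = ((0 : (W → Fin 3 → ℝ)), (1 : ℝ)) := by
    intro k e r hr
    simp only [Function.comp_apply, σ, decide_eq_true_eq] at hr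
    simp [wd, hr]
  have hwt : ∀ {k : ℕ} (e : Fin k → Fin n) (r : Fin k), (σ ∘ e) r = false → ((wd ∘ e) r).2 = 0 := by
    intro k e r hr
    simp only [Function.comp_apply, σ, decide_eq_false_iff_not] at hr
    simp [wd, hr]
  -- the readers and cofactors on the product space
  let H₁ : (W → Fin 3 → ℝ) × ℝ → ℂ := fun z => Φ₁ (g z.1) z.2
  let H₂ : (W → Fin 3 → ℝ) × ℝ → ℂ := fun z => Φ₂ (g z.1) z.2
  let M₁ : (W → Fin 3 → ℝ) × ℝ → ℂ := fun z => K₁ * (ce z.2 * Pf z.1 - Ef z.1)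
  let M₂ : (W → Fin 3 → ℝ) × ℝ → ℂ := fun z => K₂ * (ch z.2 * Pf z.1 - Ef z.1)
  have hO₁ : IsOpen (Q ×ˢ T₁ : Set ((W → Fin 3 → ℝ) × ℝ)) := hQ.prod hT₁
  have hO₂ : IsOpen (Q ×ˢ (univ : Set ℝ) : Set ((W → Fin 3 → ℝ) × ℝ)) := hQ.prod isOpen_univ
  have hH₁ : ContDiffOn ℝ ∞ H₁ (Q ×ˢ T₁) := h1₁ g hg
  have hH₂ : ContDiffOn ℝ ∞ H₂ (Q ×ˢ (univ : Set ℝ)) := h1₂ g hg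
  have hM₁ : ContDiffOn ℝ ∞ M₁ (Q ×ˢ (univ : Set ℝ)) :=
    contDiffOn_cofactorReader ce hce K₁ (fun q _ => (Pf q, Ef q)) (hPf.prodMk hEf)
  have hM₂ : ContDiffOn ℝ ∞ M₂ (Q ×ˢ (univ : Set ℝ)) :=
    contDiffOn_cofactorReader ch hch K₂ (fun q _ => (Pf q, Ef q)) (hPf.prodMk hEf)
  -- the product functions on the product space and the two chart identities
  have hG₁ : ∀ c ∈ U₁, (c w i - c w j) / 2 ∈ T₁ → F₁ c = (fun z => M₁ z * H₁ z) (A₁ c) := by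
    intro c hc hT; rw [hdesc₁ c hc hT, hA₁]
  have hG₂ : ∀ c ∈ U₂, F₂ c = (fun z => M₂ z * H₂ z) (A₂ c) := by
    intro c hc; rw [hdesc₂ c hc, hA₂]
  -- STEP 1: transport the compact-chart jet to the product space, eventually along the punctured normal
  have hbase₁ : ∀ t : ℝ, A₁ (p + t • hcNrm w i j) = (p, t) := wallChart_add_smul_hcNrm hij hA₁ hp
  have hLHS : ∀ᶠ ν : ℝ in 𝓝[≠] 0, iteratedFDeriv ℝ n F₁ (p + ν • hcNrm w i j) (fun r => hcAdaptedVec w i j (m r)) =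
      iteratedFDeriv ℝ n (fun z => M₁ z * H₁ z) ((p, (0 : ℝ)) + ν • ((0 : (W → Fin 3 → ℝ)), (1 : ℝ))) wd := by
    have hU₁' : ∀ᶠ ν : ℝ in 𝓝[≠] 0, p + ν • hcNrm w i j ∈ U₁ :=
      nhdsWithin_le_nhds (tendsto_ray_nhds_zero p (hcNrm w i j) (hU₁.mem_nhds hpU₁))
    filter_upwards [hU₁', hray] with ν hνU hνT
    have hνc : ((p + ν • hcNrm w i j) w i - (p + ν • hcNrm w i j) w j) / 2 = ν := by
      have := congrArg Prod.snd (hbase₁ ν); rw [hA₁] at this; exact this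
    -- `F₁ = (M₁·H₁) ∘ A₁` on the open set `U₁ ∩ ν⁻¹(T₁) ∋ p + ν n`
    have hopen : IsOpen (U₁ ∩ {c : (W → Fin 3 → ℝ) | (c w i - c w j) / 2 ∈ T₁}) := by
      refine hU₁.inter (hT₁.preimage ?_)
      fun_prop
    have hmem : p + ν • hcNrm w i j ∈ U₁ ∩ {c : (W → Fin 3 → ℝ) | (c w i - c w j) / 2 ∈ T₁} := ⟨hνU, by rw [Set.mem_setOf_eq, hνc]; exact hνT⟩
    have hev : F₁ =ᶠ[𝓝 (p + ν • hcNrm w i j)] ((fun z => M₁ z * H₁ z) ∘ A₁) :=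
      Filter.eventuallyEq_of_mem (hopen.mem_nhds hmem) fun c hc => hG₁ c hc.1 hc.2
    rw [(hev.iteratedFDeriv ℝ n).eq_of_nhds]
    have hAc : A₁ (p + ν • hcNrm w i j) ∈ (Q ×ˢ T₁ : Set ((W → Fin 3 → ℝ) × ℝ)) := by rw [hbase₁]; exact ⟨hpQ, hνT⟩
    rw [iteratedFDeriv_comp_clm_apply_of_isOpen A₁ hO₁ ((hM₁.mono (prod_mono le_rfl (subset_univ _))).mul hH₁) hAc, hbase₁,
      show (⇑A₁ ∘ fun r => hcAdaptedVec w i j (m r)) = wd from hwA₁]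
    congr 1
    simp
  -- STEP 2: the sub-word jets of `H₁` along the ray are in NORMAL FORM, with ONE family per sub-word for BOTH readers
  let T : Bool → Set ℝ := fun b => if b then T₁ else univ
  let Φ : Bool → (Y → V) → ℝ → ℂ := fun b => if b then Φ₁ else Φ₂
  have hT : ∀ b, IsOpen (T b) := fun b => by cases b <;> simp [T, hT₁]
  have h1 : ∀ b g, Adm g → ContDiffOn ℝ ∞ (fun z : (W → Fin 3 → ℝ) × ℝ => Φ b (g z.1) z.2) (Q ×ˢ T b) := fun b g hg => by
    cases b
    · simpa [Φ, T] using h1₂ g hg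
    · simpa [Φ, T] using h1₁ g hg
  have h2 : ∀ b g, Adm g → ∀ (v : (W → Fin 3 → ℝ)) (z : (W → Fin 3 → ℝ) × ℝ), z ∈ Q ×ˢ T b → fderiv ℝ (fun z : (W → Fin 3 → ℝ) × ℝ => Φ b (g z.1) z.2) z (v, 0) = Φ b (D v g z.1) z.2 := fun b g hg v z hz => by
    cases b
    · simpa [Φ, T] using h2₂ g hg v z (by simpa [T] using hz)
    · simpa [Φ, T] using h2₁ g hg v z (by simpa [T] using hz)
  -- normal form of a sub-word `e : Fin k → Fin n`
  have hNF : ∀ {k : ℕ} (e : Fin k → Fin n), ∃ g' : (W → Fin 3 → ℝ) → Y → V, Adm g' ∧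
      (∀ z : (W → Fin 3 → ℝ) × ℝ, z ∈ Q ×ˢ T₁ → iteratedFDeriv ℝ k H₁ z (wd ∘ e) = iteratedDeriv ((List.ofFn (σ ∘ e)).count true) (Φ₁ (g' z.1)) z.2) ∧
      (∀ z : (W → Fin 3 → ℝ) × ℝ, z ∈ Q ×ˢ (univ : Set ℝ) → iteratedFDeriv ℝ k H₂ z (wd ∘ e) = iteratedDeriv ((List.ofFn (σ ∘ e)).count true) (Φ₂ (g' z.1)) z.2) := by
    intro k e
    obtain ⟨hAdm, hnf⟩ := iteratedFDeriv_readers_eq_iteratedDeriv_foldr_local hQ T hT Φ Adm D hcl h1 h2 (wd ∘ e) (σ ∘ e) (hwn e) (hwt e) g hg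
    refine ⟨_, hAdm, fun z hz => ?_, fun z hz => ?_⟩
    · simpa [Φ, T] using hnf true z (by simpa [T] using hz)
    · simpa [Φ, T] using hnf false z (by simpa [T] using hz)
  -- the count of a sub-word
  have hcount : ∀ {k : ℕ} (e : Fin k → Fin n), (List.ofFn (σ ∘ e)).count true = (Finset.univ.filter fun r : Fin k => m (e r) = (w, i)).card := by
    intro k e
    rw [count_ofFn_true_eq_card]
    congr 1
    ext r
    simp [σ]
  -- STEP 3: Leibniz for jumps along the ray on the product space
  choose gs hgsAdm hgs₁ hgs₂ using fun s : Finset (Fin n) => hNF (⇑(s.orderEmbOfFin rfl))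
  have hrayO : ∀ᶠ t : ℝ in 𝓝[≠] 0, ((p, (0 : ℝ)) + t • ((0 : (W → Fin 3 → ℝ)), (1 : ℝ)) : (W → Fin 3 → ℝ) × ℝ) ∈ (Q ×ˢ T₁ : Set ((W → Fin 3 → ℝ) × ℝ)) := by
    filter_upwards [hray] with t ht
    exact ⟨by simpa using hpQ, by simpa using ht⟩
  have hJ : ∀ s : Finset (Fin n), HasOneSidedJump
      (fun t : ℝ => iteratedFDeriv ℝ s.card H₁ ((p, (0 : ℝ)) + t • ((0 : (W → Fin 3 → ℝ)), (1 : ℝ))) (wd ∘ ⇑(s.orderEmbOfFin rfl)))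
      (κ * I ^ (Finset.univ.filter fun r : Fin s.card => m (s.orderEmbOfFin rfl r) = (w, i)).card * iteratedDeriv
        (Finset.univ.filter fun r : Fin s.card => m (s.orderEmbOfFin rfl r) = (w, i)).card (Φ₂ (gs s p)) 0) := by
    intro s
    rw [← hcount]
    refine hasOneSidedJump_congr_ev (hjump (gs s) (hgsAdm s) _) ?_
    filter_upwards [hrayO] with t ht
    rw [hgs₁ s _ ht]
    simp
  have hLeib := hasOneSidedJump_iteratedFDeriv_mul_ray_of_jumps hO₂ hO₁ (x := ((p, (0 : ℝ)) : (W → Fin 3 → ℝ) × ℝ)) (v := ((0 : (W → Fin 3 → ℝ)), (1 : ℝ)))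
    ⟨hpQ, mem_univ _⟩ hM₁ hH₁ hrayO wd hJ
  -- STEP 4: the split side at the Cayley point, in the same words
  have hbase₂ : A₂ (hcCayPt w i j p) = (p, 0) := cayleyChart_hcCayPt hij hA₂ hp
  have hz₀ : ((p, (0 : ℝ)) : (W → Fin 3 → ℝ) × ℝ) ∈ (Q ×ˢ (univ : Set ℝ) : Set ((W → Fin 3 → ℝ) × ℝ)) := ⟨hpQ, mem_univ _⟩
  have hRHS : iteratedFDeriv ℝ n F₂ (hcCayPt w i j p) (fun r => hcCayVec w i j (m r)) =
      ∑ s : Finset (Fin n), iteratedFDeriv ℝ s.card M₂ (p, 0) (wd ∘ ⇑(s.orderEmbOfFin rfl)) *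
        iteratedDeriv (Finset.univ.filter fun r : Fin sᶜ.card => m (sᶜ.orderEmbOfFin rfl r) = (w, i)).card (Φ₂ (gs sᶜ p)) 0 := by
    have hev : F₂ =ᶠ[𝓝 (hcCayPt w i j p)] ((fun z => M₂ z * H₂ z) ∘ A₂) :=
      Filter.eventuallyEq_of_mem (hU₂.mem_nhds hpU₂) fun c hc => hG₂ c hc
    rw [(hev.iteratedFDeriv ℝ n).eq_of_nhds, iteratedFDeriv_comp_clm_apply_of_isOpen A₂ hO₂ (hM₂.mul hH₂) (by rw [hbase₂]; exact hz₀), hbase₂,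
      show (⇑A₂ ∘ fun r => hcCayVec w i j (m r)) = wd from hwA₂, iteratedFDeriv_mul_apply_eq_sum_powerset hO₂ n
        ((hM₂.of_le (by exact_mod_cast le_top))) ((hH₂.of_le (by exact_mod_cast le_top))) hz₀ wd]
    refine Finset.sum_congr rfl fun s _ => ?_
    rw [hgs₂ sᶜ _ hz₀, hcount]
  -- STEP 5: collect — Wick on the cofactor jets, the powers of `I` into the Cayley scalar
  have hW : ∀ s : Finset (Fin n), K₂ * iteratedFDeriv ℝ s.card M₁ (p, 0) (wd ∘ ⇑(s.orderEmbOfFin rfl)) =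
      K₁ * I ^ (Finset.univ.filter fun r : Fin s.card => m (s.orderEmbOfFin rfl r) = (w, i)).card * iteratedFDeriv ℝ s.card M₂ (p, 0) (wd ∘ ⇑(s.orderEmbOfFin rfl)) := by
    intro s
    rw [← hcount]
    exact cofactor_wick_words hQ Pf Ef hPf hEf ce ch hce hch hwick K₁ K₂ (wd ∘ ⇑(s.orderEmbOfFin rfl)) (σ ∘ ⇑(s.orderEmbOfFin rfl))
      (hwn _) (hwt _) hpQ
  -- rewrite the Leibniz jump value into the stated one
  obtain ⟨Lp, Lm, hLp, hLm, hJump⟩ := hLeib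
  refine hasOneSidedJump_congr_ev ⟨Lp, Lm, hLp, hLm, ?_⟩ (hLHS.mono fun ν hν => hν.symm)
  rw [hJump, hRHS, Finset.mul_sum]
  refine Finset.sum_congr rfl fun s _ => ?_
  have hWs := hW s
  have hI := I_pow_mul_I_pow_eq_hcCayScalar w i m s
  -- `D^s M₁ · (κ I^{a'} Λ') = (K₁/K₂) I^{a} D^s M₂ · κ I^{a'} Λ' = (K₁/K₂) κ (I^a I^{a'}) D^s M₂ Λ'`
  have hM₁eq : iteratedFDeriv ℝ s.card M₁ (p, 0) (wd ∘ ⇑(s.orderEmbOfFin rfl)) =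
      K₁ / K₂ * I ^ (Finset.univ.filter fun r : Fin s.card => m (s.orderEmbOfFin rfl r) = (w, i)).card * iteratedFDeriv ℝ s.card M₂ (p, 0) (wd ∘ ⇑(s.orderEmbOfFin rfl)) := by
    field_simp
    linear_combination hWs
  rw [hM₁eq, ← hI]
  ring

end Literature.NumberTheory.Rogawski1990
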